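import Literature.Analysis.OperatorTheory.Enflo2023.PartAStart
import Literature.Analysis.OperatorTheory.Enflo2023.ClaimRun
import HarnessLib

/-!
# Enflo (2023): Part B's residual asked AT THE MANUSCRIPT'S OWN START (no data left existential)

Source: P. H. Enflo, arXiv:2305.15442v2 — a CLAIMED result under adjudication (b2b-enflo repair cell).  This file
records an IMPLICATION whose hypothesis is open; nothing here concludes the invariant subspace problem for an
arbitrary operator.  BLOCK-2b value: a precise statement of what remains.

`ClaimRun`'s end-to-end records (`EndToEnd.isp_of_partBResidualRun`, `isp_of_partBResidualClass`, formaliser 2) take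
the Part-B step claim packaged TOGETHER with existentially quantified Part-A standing data (`∃ x₀ y₀ u₀ …`).  With
`PartAStart` (the WLOG standing form of pp.1–2 and the standing block at `y₁'` as theorems) the data can be FIXED to
the manuscript's: `StepClaimAtStart` asks, for every operator of the standing form (`‖T‖ = 10⁻²⁰`, dense range,
injective, not onto), every orthonormal pair `u₀, u₁` with the sharpened p.7 choice `‖T*u₁‖ ≤ ¼·10⁻⁴`, and every
Lemma-1 minimiser `ℓ'_ε` (`ε ∈ [½ − 2·10⁻⁴, ½]`, `(εθ)₀ ≤ 10⁻⁴`) — i.e. at the manuscript's `x₀ = (√3/2)u₀ + ½u₁`,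
`y₁' = V_{y₀'}ℓ'_ε` — constants `C, β, G` and, from every start-quality state of the Main Construction started there
(`EndToEnd.Ctrl33`, (33) with Lemma 3), SOME class of states containing it on which the restricted step claim
`MCStep.ClaimG` holds (v2 p.17 l.578–583 with (40), (45), (46)).  `isp_of_stepClaimAtStart`: this alone implies
`Referee.ISP_separable` — the referee's glue G2 / census R-V16 in its strongest reading.  Logically
`StepClaimAtStart ⇒ ISP_separable ⇒ PartBResidualClass` (the latter by its invariant-subspace disjunct), so as a
HYPOTHESIS it is not weaker than formaliser 2's packages; its point is faithfulness: no datum of the start is left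
for the reader to choose, and Part A contributes nothing further.

Origin: planner-b2b-enflo-1-g9-0 (formaliser 1, gen 9), 2026-08-19.
-/

noncomputable section

open scoped InnerProductSpace
open Filter Topology ContinuousLinearMap

namespace Literature.Analysis.OperatorTheory.Enflo2023

namespace PartAStart

open Vy Lemma1 Lemma2 MCStep EndToEnd

/-- **Part B's step claim at the manuscript's own start** (v2 p.17 l.578–583, asked only from start-quality states
of the Main Construction begun at `y₁'` of Lemma 1, for operators in the standing form of p.1 and the p.7 data with
the sharpened `u₁`).  A HYPOTHESIS — proved nowhere in the tree. [cite: Enflo2023, v2 p.1 (standing hypotheses), p.7 (x₀, u₁), pp.8–9 Lemma 1, p.15 (33), p.17 l.578–583, (40), (45), (46)] -/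
@[claim "Enflo2023" "disputed"]
def StepClaimAtStart : Prop :=
  ∀ (H : Type) [NormedAddCommGroup H] [InnerProductSpace ℂ H] [CompleteSpace H]
    [TopologicalSpace.SeparableSpace H], ¬ FiniteDimensional ℂ H →
    ∀ (T : H →L[ℂ] H) (hT : ‖T‖ < 1), ‖T‖ = 1e-20 → DenseRange T → Function.Injective T →
      ¬ Function.Surjective T →
    ∀ (u₀ u₁ : H), ‖u₀‖ = 1 → ‖u₁‖ = 1 → ⟪u₀, u₁⟫_ℂ = 0 → ‖adjoint T u₁‖ ≤ (1 / 10 ^ 4) / 4 →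
    ∀ (ε : ℝ) (a : ℓ2), 1 / 2 - 2 * (1 / 10 ^ 4) ≤ ε → ε ≤ 1 / 2 →
      IsMinimal (V T hT (yStart u₀)) (xStart u₀ u₁) ε a →
      (⟪xStart u₀ u₁ - V T hT (yStart u₀) a, V T hT (yStart u₀) a⟫_ℂ).re ≤ 1 / 10 ^ 4 →
      ∃ (C β : ℝ) (G : ℝ → ℝ), 0 ≤ C ∧ 0 < β ∧ β ≤ 1 ∧ (∀ x, 0 ≤ G x)
        ∧ (∀ η : ℝ, 0 < η → ∃ δ : ℝ, 0 < δ ∧ ∀ x, 0 ≤ x → x ≤ δ → G x ≤ η)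
        ∧ ∀ s₀ : State T (xStart u₀ u₁) Vy.S,
            Ctrl33 T hT u₀
                (1.12 * (⟪xStart u₀ u₁ - V T hT (yStart u₀) a, V T hT (yStart u₀) a⟫_ℂ).re) s₀ →
              ∃ Good : State T (xStart u₀ u₁) Vy.S → Prop,
                Good s₀ ∧ ClaimG T (xStart u₀ u₁) Vy.S C β G Good

/-- **For a standing-form operator, the step claim at the manuscript's start gives an invariant subspace.**
`‖T‖ = 10⁻²⁰`, dense range, not onto (injectivity is not used), on an infinite-dimensional space: pick any unit `u₀`,
the sharpened `u₁` (`Lemma1.exists_unit_orthogonal_adjoint_le`), the Lemma-1 minimiser `y₁'`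
(`PartAStart.exists_standing_data` with `t = 10⁻⁴`), then `EndToEnd.nis_of_partA_and_exists_claimG`. [cite: Enflo2023, v2 p.1, p.7, pp.8–9, p.15 (33), p.17 l.578–583, p.22 (11)] -/
theorem nis_of_stepClaimAtStart {H : Type} [NormedAddCommGroup H] [InnerProductSpace ℂ H] [CompleteSpace H]
    [TopologicalSpace.SeparableSpace H] (hH : ¬ FiniteDimensional ℂ H) (hR : StepClaimAtStart)
    (T : H →L[ℂ] H) (hnorm : ‖T‖ = 1e-20) (hdense : DenseRange T) (hinj : Function.Injective T)
    (hsurj : ¬ Function.Surjective T) : HasNontrivialClosedInvariantSubspace T := by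
  have hT : ‖T‖ < 1 := by rw [hnorm]; norm_num
  have hT20 : ‖T‖ ≤ 1 / 10 ^ 20 := by rw [hnorm]; norm_num
  have hT10 : ‖T‖ ≤ 1 / 10 := hT20.trans (by norm_num)
  have hN : Nontrivial H := by
    by_contra h
    rw [not_nontrivial_iff_subsingleton] at h
    exact hH (Module.Finite.of_surjective (0 : (Fin 0 → ℂ) →ₗ[ℂ] H) fun x => ⟨0, Subsingleton.elim _ _⟩)
  obtain ⟨u₀, hu₀⟩ := exists_norm_eq H zero_le_one
  have ht0 : (0 : ℝ) < 1 / 10 ^ 4 := by norm_num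
  obtain ⟨u₁, hu₁, h01, hη⟩ :=
    exists_unit_orthogonal_adjoint_le T hdense hsurj u₀ hu₀ (η := (1 / 10 ^ 4) / 4) (by norm_num)
  obtain ⟨y₀, hx₀, hwin, him, hθ0, hθ, h9, hu₀', hcone, ε, a, hε1, hε2, ha, hy₀⟩ :=
    exists_standing_data T hT hT10 u₀ u₁ hu₀ hu₁ h01 ht0 le_rfl hη
  subst hy₀
  obtain ⟨C, β, G, hC, hβ, hβ1, hG0, hG, hclaim⟩ :=
    hR H hH T hT hnorm hdense hinj hsurj u₀ u₁ hu₀ hu₁ h01 hη ε a hε1 hε2 ha hθ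
  exact nis_of_partA_and_exists_claimG T hT hT20 (xStart u₀ u₁) _ u₀ hx₀ hwin him hθ0 (hθ.trans le_rfl) h9
    hu₀' hcone hC hβ hβ1 G hG0 hG hclaim

/-- **End to end from the manuscript's own start.**  `StepClaimAtStart ⟹ Referee.ISP_separable`: every operator on
a separable infinite-dimensional Hilbert space has a non-trivial closed invariant subspace outright or is equivalent
to a standing-form `T'` (`PartAStart.standing_form`), to which `nis_of_stepClaimAtStart` applies.  An IMPLICATION;
its hypothesis is open. [cite: Enflo2023, v2 pp.1–2, p.7, pp.8–9, pp.17–22] -/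
theorem isp_of_stepClaimAtStart (hR : StepClaimAtStart) : Referee.ISP_separable := by
  intro H _ _ _ _ hH T
  rcases standing_form hH T with hnis | ⟨T', hnorm, hdense, hinj, hsurj, htrans⟩
  · exact hnis
  · exact htrans (nis_of_stepClaimAtStart hH hR T' hnorm hdense hinj hsurj)

/-- Order: the start-anchored claim implies formaliser 2's weakest package (through the invariant subspace it
yields — the comparison is by strength as hypotheses, not a new route). [cite: Enflo2023, v2 pp.17–22] -/
theorem partBResidualClass_of_stepClaimAtStart (hR : StepClaimAtStart) : PartBResidualClass := by
  intro H _ _ _ _ hH T hT _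
  exact Or.inl (isp_of_stepClaimAtStart hR H hH T)

end PartAStart

end Literature.Analysis.OperatorTheory.Enflo2023
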